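import Summits.FinalStateConjecture.FinalStateConjecture.Theorems.PhotonSphereChannelsTameEternalLimitDefs
import Literature.Geometry.Lorentzian.EventHorizon
import Literature.Geometry.Lorentzian.CausalityPushUp
import Literature.Geometry.Lorentzian.IdealPoints
import Literature.Geometry.Lorentzian.NoncompactCauchyFutureSet
import Summits.FinalStateConjecture.FinalStateConjecture.Statement
import HarnessLib

/-!
# Route PhotonSphereChannels · crux `ChannelsResolveTameDevelopmentsR` (K2R-T2, stmt-FinalStateConjecture-17430) —
# posited vocabulary of the line `Sketch` (gen 1, idea `end-visible-rays-quarantine`): END-VISIBILITY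
# (route-posited definitions, D-0016 `<Route>Defs` convention; pattern of `PhotonSphereChannelsTameEternalLimitDefs.lean`)

The rev-15 crux is `K1R → Φ_T2` with `K1R` proved, and `Φ_T2`'s consequent carries the intrinsic
lower bound (C) `Summit.FinalStateConjecture.RaysStayInClosure 𝒟 O` on the settled region: EVERY
future-complete normalised null ray from EVERY point of the data hypersurface stays in `closure O`.
The line `Sketch` (skeleton `Cruxes/ChannelsResolveTameDevelopmentsR/Lines/Sketch.lean`, lead
prover-line-stmt-FinalStateConjecture-17430-0) splits the crux EXACTLY along end-visibility:
`crux ⇐ NoHidden ∧ K2REnd`, `crux ⇒ K2REnd`, where K2REnd is the crux with (C) weakened to C_end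
(`EndVisibleRaysStayInClosure`) and NoHidden (`CompleteRaysNearEndVisible` under the crux's
hypotheses) is the pure causal-topology residue "no future-complete null geodesic from `Σ` is hidden
from the asymptotically flat end" — plausibly false on `X = ℝ³ # N`, `σ(N) ≤ 0` (hidden expanding
vacuum bag; refuter evidence BAG.md / CruxAttack17430 §5 on the item), operator-contingent.

This file is the vocabulary over which the two registered stubs are stated, moved out of the crux
workfile so that stub proofs, model certificates and negative lemmas can be landed as `Theorems/…`
files importing it. It carries definitions and their elementary set-level API only (all proved):

* §1 `IsEndVisibleEvent 𝒟 q`, `endVisibleRegion 𝒟` — the tree's bag-blind `IsVisibleEvent`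
  ("`q ∈ J⁻(𝓘⁺)`", `VisibleIncompleteNullRay.lean`) with the launch point of the witnessing complete
  ray pushed out through the end (`∃ p` ↦ `∀ K compact, ∃ p ∉ K`), in the idiom of the sojourn form of
  complete `𝓘⁺`; a past set contained in the visible region, to the future of the data contained in
  the outer region (= hypothesis (ii)'s `outer`, `TrappedSet.outerRegion`, = `LorentzianMetric.outerRegion`).
* §2 `EndVisibleRaysStayInClosure 𝒟 O` (C_end), `CompleteRaysNearEndVisible 𝒟` (NoHidden per
  development), `FarRaysShadowedBy 𝒟 C`; the exact split at the level of one development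
  (`raysStayInClosure_of_endVisible`, `endVisibleRaysStayInClosure_of_raysStayInClosure`); C_end is
  free, set level, for a chart shadowing the far rays
  (`endVisibleRegion_inter_causalFuture_subset_exteriorOf`); (C) forces the whole outer region into
  `O` (`outerRegion_subset_exteriorOf_of_raysStayInClosure`); NoHidden makes the outer region
  end-visible (`outerRegion_subset_endVisibleRegion_of_completeRaysNearEndVisible`).
* §3 `SettlesEndVisibly 𝒟` — the crux's T2 consequent per development with (C) replaced by C_end
  (the conclusion of stub `stub_k2REnd`), and `settlesEndVisibly_of_settlesT2`.

Hypotheses (i)/(ii) are NOT re-declared: they are `TrappedSet.NoExtremalRemnant` /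
`TrappedSet.TameOuterRegion` of `PhotonSphereChannelsTameEternalLimitDefs.lean` (verbatim the route
text). Nothing here restates a route item; this module does not import `Theses.PhotonSphereChannels`.

References: Hawking–Ellis 1973, §6.8 (past sets), §9.2 (`J⁻(𝓘⁺)`, black-hole region); Wald 1984,
§12.1; O'Neill 1983, Ch. 14 (Lemma 14.3, p. 402); Christodoulou, CQG 16 (1999) A23, pp. A26–A27;
Dafermos–Luk, arXiv:1710.01722, Conjecture 1 and p. 10 (no interior claim).
-/

noncomputable section

set_option linter.dupNamespace false

open Set Filter Topology TopologicalSpace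
open scoped Manifold ContDiff ENNReal
open Literature.Geometry.Lorentzian

namespace Summit.FinalStateConjecture.FinalStateConjecture.Theorems.EndVisible

variable {X : Type} [TopologicalSpace X] [ChartedSpace E3 X] [IsManifold (𝓡 3) ∞ X]
  [ConnectedSpace X] {D : InitialDataSet (𝓡 3) X}

/-! ## §1. End-visible events -/

/-- The event `q` of the Cauchy development `𝒟` is **end-visible**: for EVERY compact `K ⊆ X` there
are a launch point `p ∉ K` and a future-complete normalised null ray `δ` from `p`
(`IsNormalisedNullRayFrom`, affine domain `s` unbounded above) with `q ∈ I⁻(δ(s ∩ [0, ∞)))` — the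
intrinsic `q ∈ J⁻(𝓘⁺)` of Hawking–Ellis/Wald (`LorentzianMetric.IsVisibleEvent`) with the witnessing
ray launched outside every compact piece of the data, as in the sojourn form of complete `𝓘⁺`
(`HasCompleteFutureNullInfinity`: `∀ s ∃ B₁ ∀ p ∉ B₁`). [cite: HawkingEllis1973, §9.2] -/
def IsEndVisibleEvent (𝒟 : CauchyDevelopment D) [𝒟.metric.HasLeviCivita] (q : 𝒟.carrier) : Prop :=
  ∀ K : Set X, IsCompact K → ∃ p ∉ K, ∃ (δ : ℝ → 𝒟.carrier) (s : Set ℝ),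
    𝒟.metric.IsNormalisedNullRayFrom 𝒟.timeOrientation 𝒟.embed 𝒟.normal p δ s ∧ ¬ BddAbove s ∧
      q ∈ 𝒟.metric.chronologicalPast 𝒟.timeOrientation (δ '' (s ∩ Ici 0))

/-- The **end-visible region** of `𝒟`: the set of end-visible events (the past of the far-launched
complete rays). [cite: HawkingEllis1973, §9.2] -/
def endVisibleRegion (𝒟 : CauchyDevelopment D) [𝒟.metric.HasLeviCivita] : Set 𝒟.carrier :=
  {q | IsEndVisibleEvent 𝒟 q}

variable {𝒟 : CauchyDevelopment D}

/-- Unfolding lemma for the end-visible region. [cite: HawkingEllis1973, §9.2] -/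
@[simp]
theorem mem_endVisibleRegion_iff [𝒟.metric.HasLeviCivita] {q : 𝒟.carrier} :
    q ∈ endVisibleRegion 𝒟 ↔ IsEndVisibleEvent 𝒟 q :=
  Iff.rfl

/-- An end-visible event is visible from infinity in the tree's sense (take `K = ∅`).
[cite: HawkingEllis1973, §9.2] -/
theorem IsEndVisibleEvent.isVisibleEvent [𝒟.metric.HasLeviCivita] {q : 𝒟.carrier}
    (h : IsEndVisibleEvent 𝒟 q) :
    𝒟.metric.IsVisibleEvent 𝒟.timeOrientation 𝒟.embed 𝒟.normal q := by
  obtain ⟨p, -, δ, s, hδ, hs, hq⟩ := h ∅ isCompact_empty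
  exact ⟨p, δ, s, hδ, hs, hq⟩

/-- The end-visible region is contained in the visible region `J⁻(𝓘⁺) ∩ M` (the only inclusion
between the two: a hidden future-complete region is visible but not end-visible).
[cite: HawkingEllis1973, §9.2] -/
theorem endVisibleRegion_subset_visibleRegion [𝒟.metric.HasLeviCivita] :
    endVisibleRegion 𝒟 ⊆ 𝒟.metric.visibleRegion 𝒟.timeOrientation 𝒟.embed 𝒟.normal :=
  fun _ hq ↦ IsEndVisibleEvent.isVisibleEvent hq

/-- End-visibility is inherited by the chronological past (`r ≪ q`, `q` end-visible ⇒ `r`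
end-visible), by transitivity of `≪`. [cite: HawkingEllis1973, §6.8] -/
theorem IsEndVisibleEvent.of_mem_chronologicalPast [𝒟.metric.HasLeviCivita] {q r : 𝒟.carrier}
    (hq : IsEndVisibleEvent 𝒟 q) (hr : r ∈ 𝒟.metric.chronologicalPast 𝒟.timeOrientation {q}) :
    IsEndVisibleEvent 𝒟 r := by
  intro K hK
  obtain ⟨p, hp, δ, s, hδ, hs, hq⟩ := hq K hK
  exact ⟨p, hp, δ, s, hδ, hs, LorentzianMetric.mem_chronologicalPast_trans hq hr⟩

/-- **The end-visible region is a past set**: `I⁻(endVisibleRegion) ⊆ endVisibleRegion`.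
[cite: HawkingEllis1973, §6.8] -/
theorem isPastSet_endVisibleRegion [𝒟.metric.HasLeviCivita] :
    𝒟.metric.IsPastSet 𝒟.timeOrientation (endVisibleRegion 𝒟) := by
  rintro r ⟨q, hq, hr⟩
  exact IsEndVisibleEvent.of_mem_chronologicalPast hq ⟨q, rfl, hr⟩

/-- Hypothesis (ii)'s outer region `TrappedSet.outerRegion 𝒟` IS the tree's future domain of outer
communications `LorentzianMetric.outerRegion` (`EventHorizon.lean`), definitionally.
[cite: HawkingEllis1973, §9.2] -/
theorem outerRegion_eq_outerRegion (𝒟 : CauchyDevelopment D) [𝒟.metric.HasLeviCivita] :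
    TrappedSet.outerRegion 𝒟 = 𝒟.metric.outerRegion 𝒟.timeOrientation 𝒟.embed 𝒟.normal :=
  rfl

/-- The end-visible region to the causal future of the data lies in the outer region.
[cite: HawkingEllis1973, §9.2] -/
theorem endVisibleRegion_inter_causalFuture_subset_outerRegion [𝒟.metric.HasLeviCivita] :
    endVisibleRegion 𝒟 ∩ 𝒟.metric.causalFuture 𝒟.timeOrientation (range 𝒟.embed) ⊆
      TrappedSet.outerRegion 𝒟 :=
  fun _ hq ↦ ⟨hq.2, endVisibleRegion_subset_visibleRegion hq.1⟩

/-! ## §2. C_end, NoHidden (per development), shadowing -/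

/-- **C_end** (`EndVisibleRaysStayInClosure 𝒟 O`): every point `γ t`, `t ≥ 0`, of every
future-complete normalised null ray from the data which lies in `closure (endVisibleRegion 𝒟)` lies
in `closure O` — the summit's clause (C) `RaysStayInClosure 𝒟 O` with its quantifier restricted to
the ray points the asymptotically flat end can see, up to closure (so horizon generators are kept).
[cite: DafermosLuk2017, Conjecture 1] -/
def EndVisibleRaysStayInClosure (𝒟 : CauchyDevelopment D) (O : Set 𝒟.carrier) : Prop :=
  ∀ [𝒟.metric.HasLeviCivita], ∀ (p : X) (γ : ℝ → 𝒟.carrier) (dom : Set ℝ),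
    𝒟.metric.IsNormalisedNullRayFrom 𝒟.timeOrientation 𝒟.embed 𝒟.normal p γ dom →
      ¬ BddAbove dom → ∀ t ∈ dom, 0 ≤ t → γ t ∈ closure (endVisibleRegion 𝒟) → γ t ∈ closure O

/-- **NoHidden, per development** (`CompleteRaysNearEndVisible 𝒟`): every point `γ t`, `t ≥ 0`, of
every future-complete normalised null ray from the data lies in `closure (endVisibleRegion 𝒟)` — no
future-complete null geodesic from `Σ` is hidden from the end. A statement about black-hole
INTERIORS (Dafermos–Luk, p. 10: Conjecture 1 "makes no statement about the structure of the black
hole interior"). [cite: DafermosLuk2017, Conjecture 1] -/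
def CompleteRaysNearEndVisible (𝒟 : CauchyDevelopment D) : Prop :=
  ∀ [𝒟.metric.HasLeviCivita], ∀ (p : X) (γ : ℝ → 𝒟.carrier) (dom : Set ℝ),
    𝒟.metric.IsNormalisedNullRayFrom 𝒟.timeOrientation 𝒟.embed 𝒟.normal p γ dom →
      ¬ BddAbove dom → ∀ t ∈ dom, 0 ≤ t → γ t ∈ closure (endVisibleRegion 𝒟)

/-- **The split is exact per development, direction ⇐**: C_end `∧` NoHidden `⇒` (C).
[cite: DafermosLuk2017, Conjecture 1] -/
theorem raysStayInClosure_of_endVisible {O : Set 𝒟.carrier} (hC : EndVisibleRaysStayInClosure 𝒟 O)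
    (hN : CompleteRaysNearEndVisible 𝒟) : _root_.Summit.FinalStateConjecture.RaysStayInClosure 𝒟 O :=
  fun p γ dom hγ hdom t ht ht0 ↦ hC p γ dom hγ hdom t ht ht0 (hN p γ dom hγ hdom t ht ht0)

/-- **Registered sub-goal `stub_splitGlue` of line `Sketch`** (crux stmt-FinalStateConjecture-17430): the
per-development glue of the split, C_end `∧` NoHidden `⇒` (C) — `raysStayInClosure_of_endVisible` under
the registered name and one-line signature. [cite: DafermosLuk2017, Conjecture 1] -/
theorem stub_splitGlue : ∀ {X : Type} [TopologicalSpace X] [ChartedSpace E3 X] [IsManifold (𝓡 3) ∞ X] [ConnectedSpace X] {D : InitialDataSet (𝓡 3) X} {𝒟 : CauchyDevelopment D} {O : Set 𝒟.carrier}, EndVisibleRaysStayInClosure 𝒟 O → CompleteRaysNearEndVisible 𝒟 → _root_.Summit.FinalStateConjecture.RaysStayInClosure 𝒟 O :=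
  fun hC hN ↦ raysStayInClosure_of_endVisible hC hN

/-- **Direction ⇒, first half**: (C) `⇒` C_end (weaken the quantifier).
[cite: DafermosLuk2017, Conjecture 1] -/
theorem endVisibleRaysStayInClosure_of_raysStayInClosure {O : Set 𝒟.carrier}
    (h : _root_.Summit.FinalStateConjecture.RaysStayInClosure 𝒟 O) : EndVisibleRaysStayInClosure 𝒟 O :=
  fun p γ dom hγ hdom t ht ht0 _ ↦ h p γ dom hγ hdom t ht ht0

/-- **Far rays are shadowed by `C`** (`FarRaysShadowedBy 𝒟 C`): outside some compact `K ⊆ X` the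
chronological past of (the nonnegative half of) every future-complete normalised null ray lies in
`I⁻(C)` — "the radiation-zone chart swallows late `𝓘⁺`", the one obligation an honest endgame chart
discharges to get C_end set-level for free. [cite: DafermosLuk2017, Conjecture 1] -/
def FarRaysShadowedBy (𝒟 : CauchyDevelopment D) [𝒟.metric.HasLeviCivita] (C : Set 𝒟.carrier) : Prop :=
  ∃ K : Set X, IsCompact K ∧ ∀ p ∉ K, ∀ (δ : ℝ → 𝒟.carrier) (s : Set ℝ),
    𝒟.metric.IsNormalisedNullRayFrom 𝒟.timeOrientation 𝒟.embed 𝒟.normal p δ s → ¬ BddAbove s →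
      𝒟.metric.chronologicalPast 𝒟.timeOrientation (δ '' (s ∩ Ici 0)) ⊆
        𝒟.metric.chronologicalPast 𝒟.timeOrientation C

/-- **C_end is free for a shadowing chart, set level**: `FarRaysShadowedBy 𝒟 C` gives
`endVisibleRegion 𝒟 ∩ J⁺(ι X) ⊆ exteriorOf 𝒟 C` (`= J⁺(ι X) ∩ I⁻(C)`), not merely its closure.
[cite: DafermosLuk2017, Conjecture 1] -/
theorem endVisibleRegion_inter_causalFuture_subset_exteriorOf [𝒟.metric.HasLeviCivita]
    {C : Set 𝒟.carrier} (h : FarRaysShadowedBy 𝒟 C) :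
    endVisibleRegion 𝒟 ∩ 𝒟.metric.causalFuture 𝒟.timeOrientation (range 𝒟.embed) ⊆
      _root_.Summit.FinalStateConjecture.exteriorOf 𝒟 C := by
  rintro q ⟨hq, hqJ⟩
  obtain ⟨K, hK, hfar⟩ := h
  obtain ⟨p, hp, δ, s, hδ, hs, hq⟩ := hq K hK
  exact ⟨hqJ, hfar p hp δ s hδ hs hq⟩

/-- **Clause (C) forces the whole outer region into the settled region**: if (C) holds for
`O = exteriorOf 𝒟 U` then `outerRegion ⊆ O` — for `q ≪ δ t` with `δ` complete, `I⁺(q)` is an open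
neighbourhood (O'Neill, Lemma 14.3) of `δ t ∈ closure O`, so some `o ∈ O ⊆ I⁻(U)` has `q ≪ o`, whence
`q ∈ I⁻(U)`. In words: under (C) every event that can signal to ANY future-complete null geodesic
from `Σ` — hidden regions included — must be charted or causally below the certified slabs.
[cite: ONeillSemiRiemannian1983, Ch. 14, Lemma 14.3 (p. 403)] -/
theorem outerRegion_subset_exteriorOf_of_raysStayInClosure [𝒟.metric.HasLeviCivita]
    (U : Set 𝒟.carrier)
    (h : _root_.Summit.FinalStateConjecture.RaysStayInClosure 𝒟
      (_root_.Summit.FinalStateConjecture.exteriorOf 𝒟 U)) :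
    TrappedSet.outerRegion 𝒟 ⊆ _root_.Summit.FinalStateConjecture.exteriorOf 𝒟 U := by
  rintro q ⟨hqJ, p, δ, s, hδ, hs, hq⟩
  refine ⟨hqJ, ?_⟩
  obtain ⟨x, ⟨t, ⟨ht, ht0⟩, rfl⟩, hqx⟩ :=
    (LorentzianMetric.mem_chronologicalPast_iff_exists (g := 𝒟.metric) (τ := 𝒟.timeOrientation)).1 hq
  have hcl : δ t ∈ closure (_root_.Summit.FinalStateConjecture.exteriorOf 𝒟 U) := h p δ s hδ hs t ht ht0
  obtain ⟨o, hqo, hoO⟩ := mem_closure_iff_nhds.1 hcl _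
    ((LorentzianMetric.isOpen_chronologicalFuture_of_boundaryless 𝒟.metric 𝒟.timeOrientation {q}).mem_nhds
      hqx)
  obtain ⟨u, huU, hou⟩ :=
    (LorentzianMetric.mem_chronologicalPast_iff_exists (g := 𝒟.metric) (τ := 𝒟.timeOrientation)).1 hoO.2
  exact (LorentzianMetric.mem_chronologicalPast_iff_exists (g := 𝒟.metric) (τ := 𝒟.timeOrientation)).2
    ⟨u, huU, LorentzianMetric.mem_chronologicalFuture_trans hqo hou⟩

/-- **NoHidden makes the outer region end-visible** (not merely up to closure): if every complete-ray
point lies in `closure (endVisibleRegion 𝒟)` then `outerRegion ⊆ endVisibleRegion 𝒟` — for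
`q ≪ δ t` the open neighbourhood `I⁺(q)` of `δ t` meets the end-visible region at some `e ≫ q`, and
end-visibility passes to the past. Per development, NoHidden says exactly that the domain of outer
communications `J⁺(Σ) ∩ I⁻(all complete rays)` is already the past of the far-launched complete rays.
[cite: ONeillSemiRiemannian1983, Ch. 14, Lemma 14.3 (p. 403)] -/
theorem outerRegion_subset_endVisibleRegion_of_completeRaysNearEndVisible [𝒟.metric.HasLeviCivita]
    (h : CompleteRaysNearEndVisible 𝒟) : TrappedSet.outerRegion 𝒟 ⊆ endVisibleRegion 𝒟 := by
  rintro q ⟨-, p, δ, s, hδ, hs, hq⟩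
  obtain ⟨x, ⟨t, ⟨ht, ht0⟩, rfl⟩, hqx⟩ :=
    (LorentzianMetric.mem_chronologicalPast_iff_exists (g := 𝒟.metric) (τ := 𝒟.timeOrientation)).1 hq
  have hcl : δ t ∈ closure (endVisibleRegion 𝒟) := h p δ s hδ hs t ht ht0
  obtain ⟨e, hqe, he⟩ := mem_closure_iff_nhds.1 hcl _
    ((LorentzianMetric.isOpen_chronologicalFuture_of_boundaryless 𝒟.metric 𝒟.timeOrientation {q}).mem_nhds
      hqx)
  exact IsEndVisibleEvent.of_mem_chronologicalPast he
    (LorentzianMetric.mem_chronologicalPast_of_mem_chronologicalFuture hqe)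

/-- Under NoHidden (per development) the end-visible region and the outer region agree to the causal
future of the data: `endVisibleRegion 𝒟 ∩ J⁺(ι X) = outerRegion`. [cite: HawkingEllis1973, §9.2] -/
theorem endVisibleRegion_inter_causalFuture_eq_outerRegion [𝒟.metric.HasLeviCivita]
    (h : CompleteRaysNearEndVisible 𝒟) :
    endVisibleRegion 𝒟 ∩ 𝒟.metric.causalFuture 𝒟.timeOrientation (range 𝒟.embed) =
      TrappedSet.outerRegion 𝒟 :=
  Subset.antisymm endVisibleRegion_inter_causalFuture_subset_outerRegion fun _ hq ↦
    ⟨outerRegion_subset_endVisibleRegion_of_completeRaysNearEndVisible h hq, hq.1⟩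

/-- **The typed adapter for any future endgame stub**: if the far complete rays are shadowed by `C`
and every complete-ray point in `closure (endVisibleRegion 𝒟)` lies in the closure of its part to
the causal future of the data, then C_end holds for `O = exteriorOf 𝒟 C`.
[cite: DafermosLuk2017, Conjecture 1] -/
theorem endVisibleRaysStayInClosure_of_farRaysShadowedBy (𝒟 : CauchyDevelopment D) (C : Set 𝒟.carrier)
    (hfar : ∀ [𝒟.metric.HasLeviCivita], FarRaysShadowedBy 𝒟 C)
    (hfut : ∀ [𝒟.metric.HasLeviCivita], ∀ (p : X) (γ : ℝ → 𝒟.carrier) (dom : Set ℝ),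
      𝒟.metric.IsNormalisedNullRayFrom 𝒟.timeOrientation 𝒟.embed 𝒟.normal p γ dom → ¬ BddAbove dom →
        ∀ t ∈ dom, 0 ≤ t → γ t ∈ closure (endVisibleRegion 𝒟) →
          γ t ∈ closure (endVisibleRegion 𝒟 ∩ 𝒟.metric.causalFuture 𝒟.timeOrientation (range 𝒟.embed))) :
    EndVisibleRaysStayInClosure 𝒟 (_root_.Summit.FinalStateConjecture.exteriorOf 𝒟 C) := by
  intro _ p γ dom hγ hdom t ht ht0 hcl
  exact closure_mono (endVisibleRegion_inter_causalFuture_subset_exteriorOf hfar)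
    (hfut p γ dom hγ hdom t ht ht0 hcl)

/-! ## §3. The repaired consequent per development -/

/-- **`𝒟` settles end-visibly** (`SettlesEndVisibly 𝒟`): the T2 consequent of the crux for the
vacuum Cauchy development `𝒟` with clause (C) replaced by C_end — an honest exhaustive,
future-oriented `2`-decomposition `d` of the self-determined exterior `O = J⁺(ι X) ∩ I⁻(d.charted)`
such that every END-VISIBLE point of a future-complete normalised null ray from `Σ` stays in
`closure O`. The conclusion of the registered stub `stub_k2REnd` of line `Sketch`.
[cite: DafermosLuk2017, Conjecture 1] -/
def SettlesEndVisibly (𝒟 : VacuumCauchyDevelopment D) : Prop :=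
  ∃ (O : Set 𝒟.carrier) (d : FinalStateDecomposition 𝒟.toSpacetime O 2),
    O = _root_.Summit.FinalStateConjecture.exteriorOf 𝒟.toCauchyDevelopment d.charted ∧
      EndVisibleRaysStayInClosure 𝒟.toCauchyDevelopment O ∧
        _root_.Summit.FinalStateConjecture.HasExhaustiveCharts d ∧
          _root_.Summit.FinalStateConjecture.IsFutureOriented d

/-- The crux's own T2 consequent for `𝒟` (with (C) verbatim) implies `SettlesEndVisibly 𝒟`
(weaken (C) to C_end; same `O`, same `d`). [cite: DafermosLuk2017, Conjecture 1] -/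
theorem settlesEndVisibly_of_settlesT2 {𝒟 : VacuumCauchyDevelopment D}
    (h : ∃ (O : Set 𝒟.carrier) (d : FinalStateDecomposition 𝒟.toSpacetime O 2),
      O = _root_.Summit.FinalStateConjecture.exteriorOf 𝒟.toCauchyDevelopment d.charted ∧
        _root_.Summit.FinalStateConjecture.RaysStayInClosure 𝒟.toCauchyDevelopment O ∧
          _root_.Summit.FinalStateConjecture.HasExhaustiveCharts d ∧
            _root_.Summit.FinalStateConjecture.IsFutureOriented d) :
    SettlesEndVisibly 𝒟 := by
  obtain ⟨O, d, hO, hC, hexh, hfo⟩ := h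
  exact ⟨O, d, hO, endVisibleRaysStayInClosure_of_raysStayInClosure hC, hexh, hfo⟩

/-- Conversely, `SettlesEndVisibly 𝒟` together with NoHidden for `𝒟` gives back the crux's T2
consequent for `𝒟` verbatim (the per-development form of the line's composition).
[cite: DafermosLuk2017, Conjecture 1] -/
theorem settlesT2_of_settlesEndVisibly {𝒟 : VacuumCauchyDevelopment D} (h : SettlesEndVisibly 𝒟)
    (hN : CompleteRaysNearEndVisible 𝒟.toCauchyDevelopment) :
    ∃ (O : Set 𝒟.carrier) (d : FinalStateDecomposition 𝒟.toSpacetime O 2),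
      O = _root_.Summit.FinalStateConjecture.exteriorOf 𝒟.toCauchyDevelopment d.charted ∧
        _root_.Summit.FinalStateConjecture.RaysStayInClosure 𝒟.toCauchyDevelopment O ∧
          _root_.Summit.FinalStateConjecture.HasExhaustiveCharts d ∧
            _root_.Summit.FinalStateConjecture.IsFutureOriented d := by
  obtain ⟨O, d, hO, hC, hexh, hfo⟩ := h
  exact ⟨O, d, hO, raysStayInClosure_of_endVisible hC hN, hexh, hfo⟩

end Summit.FinalStateConjecture.FinalStateConjecture.Theorems.EndVisible
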